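import Summits.CriticalPhenomena.CardyFormulaZ2.Theses.DyadicBetaRigidity
import Summits.CriticalPhenomena.CardyFormulaZ2.Theses.CardyExpCovariance
import Summits.CriticalPhenomena.CardyFormulaZ2.Theorems.DyadicBetaRigidityDyadicBetaSufficesDilation
import Summits.CriticalPhenomena.CardyFormulaZ2.Theorems.CardyAnchoredRigidityClusterSetConnected
import Literature.Probability.RandomPlanarGeometry.ImageUnivalent
import Literature.Probability.RandomPlanarGeometry.ConformalRectangleProofs

/-!
# From dyadic to arbitrary mesh sequences: subsequential conformal invariance

Crux `DyadicLatticeBetaLaw` (stmt-CriticalPhenomena-18183, route `DyadicBetaRigidity` of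
`CardyFormulaZ2`), line `Sketch` (skeleton `Cruxes/DyadicLatticeBetaLaw/Lines/Sketch.lean`),
registered support stub `stub_subseqCI_of_dyadicSubseqCI`.

The line reduces the crux to its hard stub S1; S1 yields DYADIC subsequential conformal
invariance: along every strictly increasing `κ : ℕ → ℕ` there are a further subsequence `σ` and a
law `f` with `P[R, 2^{-κ(σ n)}] → f(η_R)` for every conformal rectangle `R` with modulus `η_R`
(second hypothesis, the conclusion of the sibling stub `stub_dyadicSubseqCI_of_S1`). This file
upgrades dyadic to ARBITRARY mesh sequences, i.e. proves the target item
`CardyExpCovariance.SubseqConformalInvariance` (stmt-CriticalPhenomena-4678) from it and from the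
mesh normal form (first hypothesis, sibling stub `stub_meshNormalForm`): every `u → 0⁺` has a
subsequence `u (ψ n) = c_n / 2^{m_n}` with `m` strictly increasing, `c_n ∈ [1/2, 1]`, `c_n → c₀`.

Proof. Take `σ, f` for `κ := m`. (A) Dilation: `(φ, x)` uniformizes `R` iff `(c₀⁻¹ φ, x)`
uniformizes `c₀⁻¹ R` (`IsUniformizing.imageUnivalent`, same marks `x`), and by exact dilation
covariance of the G02 discretisation (`DyadicLattice.bondDomainCrossingProb_dilate'`)
`P[c₀⁻¹ R, 2^{-m σ n}] = P[R, c₀ 2^{-m σ n}]`, so `P[R, c₀ / 2^{m σ n}] → f(η_R)`. (B) Scale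
continuity of each crossing probability in `log δ` (the tree's PROVED support item
`ClusterSetConnected.scaleContinuity`, stmt-CriticalPhenomena-5770): since `c_{σ n} → c₀ > 0`, the
two meshes `c_{σ n} 2^{-m σ n}` and `c₀ 2^{-m σ n}` are eventually `(1+θ)`-comparable and small, so
`P[R, c_{σ n} 2^{-m σ n}] - P[R, c₀ 2^{-m σ n}] → 0`. (C) Add.

References: B. Bollobás, O. Riordan, *Percolation* (2006), Ch. 7 §7.1; O. Schramm, S. Smirnov,
Ann. Probab. 39 (2011), §5 (continuity of crossing probabilities in the domain / mesh).
-/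

noncomputable section

open MeasureTheory Filter Set Metric Topology
open UpperHalfPlane (upperHalfPlaneSet)
open Literature.Probability.RandomPlanarGeometry Literature.Probability.LatticeModels
open Literature.Probability.Percolation

namespace Summit.CriticalPhenomena.CardyFormulaZ2.Cruxes.DyadicLatticeBetaLaw.Stubs

namespace SubseqCIOfDyadic

/-- Along a strictly increasing sequence of exponents the dyadic meshes `2^{-m n}` tend to `0`.
[folklore] -/
theorem tendsto_one_div_two_pow {m : ℕ → ℕ} (hm : StrictMono m) :
    Tendsto (fun n : ℕ => (1 : ℝ) / 2 ^ (m n)) atTop (𝓝 0) := by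
  have h1 : Tendsto (fun n : ℕ => (2 : ℝ) ^ (m n)) atTop atTop :=
    (tendsto_pow_atTop_atTop_of_one_lt one_lt_two).comp hm.tendsto_atTop
  exact tendsto_const_nhds.div_atTop h1

/-- **Scale continuity along comparable meshes.** If `c n → c₀ > 0` and the meshes `e n → 0⁺`,
then `P[R, c n · e n] - P[R, c₀ · e n] → 0`: the two meshes are eventually `(1+θ)`-comparable and
below `δ₀`, for the `θ, δ₀` of the tree's scale continuity of `δ ↦ P[R, δ]` in `log δ`
(`ClusterSetConnected.scaleContinuity`). [cite: SchrammSmirnov2011, §5 Lemma 5.1] -/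
theorem tendsto_sub_of_scaleContinuity (R : ConformalRectangle) {c : ℕ → ℝ} {c₀ : ℝ}
    (hc₀ : 0 < c₀) (hc : ∀ n, 0 < c n) (hcc : Tendsto c atTop (𝓝 c₀)) {e : ℕ → ℝ}
    (he : ∀ n, 0 < e n) (he0 : Tendsto e atTop (𝓝 0)) :
    Tendsto (fun n => bondDomainCrossingProb R (c n * e n) - bondDomainCrossingProb R (c₀ * e n))
      atTop (𝓝 0) := by
  rw [Metric.tendsto_nhds]
  intro ε hε
  obtain ⟨θ, hθ, δ₀, hδ₀, H⟩ :=
    Summit.CriticalPhenomena.CardyFormulaZ2.Theorems.ClusterSetConnected.scaleContinuity R ε hε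
  have hθc : c₀ < (1 + θ) * c₀ := by nlinarith
  -- both meshes are eventually below `δ₀`
  have h1 : ∀ᶠ n in atTop, c n * e n < δ₀ := by
    have h : Tendsto (fun n => c n * e n) atTop (𝓝 0) := by simpa using hcc.mul he0
    exact h.eventually (eventually_lt_nhds hδ₀)
  have h2 : ∀ᶠ n in atTop, c₀ * e n < δ₀ := by
    have h : Tendsto (fun n => c₀ * e n) atTop (𝓝 0) := by simpa using he0.const_mul c₀
    exact h.eventually (eventually_lt_nhds hδ₀)
  -- the two factors are eventually `(1+θ)`-comparable
  have h3 : ∀ᶠ n in atTop, c₀ < (1 + θ) * c n :=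
    (hcc.const_mul (1 + θ)).eventually (eventually_gt_nhds hθc)
  have h4 : ∀ᶠ n in atTop, c n < (1 + θ) * c₀ := hcc.eventually (eventually_lt_nhds hθc)
  filter_upwards [h1, h2, h3, h4] with n hn1 hn2 hn3 hn4
  rw [Real.dist_eq, sub_zero]
  rcases le_total (c n) c₀ with hle | hle
  · have h := H (c n * e n) (c₀ * e n) (mul_pos (hc n) (he n))
      (mul_le_mul_of_nonneg_right hle (he n).le) hn2
      ((mul_le_mul_of_nonneg_right hn3.le (he n).le).trans_eq (mul_assoc _ _ _))
    rwa [abs_sub_comm] at h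
  · exact H (c₀ * e n) (c n * e n) (mul_pos hc₀ (he n))
      (mul_le_mul_of_nonneg_right hle (he n).le) hn1
      ((mul_le_mul_of_nonneg_right hn4.le (he n).le).trans_eq (mul_assoc _ _ _))

end SubseqCIOfDyadic

/-- **Dyadic subsequential conformal invariance + the mesh normal form ⇒ subsequential conformal
invariance along every mesh sequence** (registered support stub `stub_subseqCI_of_dyadicSubseqCI`
of crux stmt-CriticalPhenomena-18183, line `Sketch`; the conclusion is the target item
`CardyExpCovariance.SubseqConformalInvariance`, stmt-CriticalPhenomena-4678). Given
`u (ψ n) = c_n / 2^{m_n}` with `c_n → c₀ ∈ [1/2, 1]` and the dyadic law `f` along a subsequence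
`σ` of `m`: `P[R, c₀ / 2^{m σ n}] = P[c₀⁻¹ R, 2^{-m σ n}] → f(η_R)` by exact dilation covariance and
transport of the uniformizing data (same marks, same modulus), and
`P[R, c_{σ n} / 2^{m σ n}] - P[R, c₀ / 2^{m σ n}] → 0` by scale continuity in `log δ`.
[cite: BollobasRiordan2006, Ch. 7 §7.1] -/
theorem stub_subseqCI_of_dyadicSubseqCI :
    (∀ u : ℕ → ℝ, Tendsto u atTop (𝓝[>] (0 : ℝ)) → ∃ ψ : ℕ → ℕ, StrictMono ψ ∧ ∃ m : ℕ → ℕ,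
      StrictMono m ∧ ∃ c : ℕ → ℝ, ∃ c₀ : ℝ, c₀ ∈ Set.Icc (1 / 2 : ℝ) 1 ∧
      (∀ n, c n ∈ Set.Icc (1 / 2 : ℝ) 1) ∧ Tendsto c atTop (𝓝 c₀) ∧
      ∀ n, u (ψ n) = c n / 2 ^ (m n)) →
    (∀ κ : ℕ → ℕ, StrictMono κ → ∃ σ : ℕ → ℕ, StrictMono σ ∧ ∃ f : ℝ → ℝ,
      ContinuousOn f (Set.Ioo 0 1) ∧ (∀ η ∈ Set.Ioo (0 : ℝ) 1, f (1 - η) = 1 - f η) ∧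
      ∀ (R : ConformalRectangle) (φ : ConformalEquiv upperHalfPlaneSet R.carrier)
        (x : Fin 4 → ℝ), R.IsUniformizing φ x →
        Tendsto (fun n : ℕ => bondDomainCrossingProb R (1 / 2 ^ (κ (σ n)))) atTop
          (𝓝 (f (crossRatio x)))) →
    Summit.CriticalPhenomena.CardyFormulaZ2.Theses.CardyExpCovariance.SubseqConformalInvariance := by
  intro hNF hD u hu
  obtain ⟨ψ, hψ, m, hm, c, c₀, hc₀, hc, hcc, hu'⟩ := hNF u hu
  obtain ⟨σ, hσ, f, -, -, hconv⟩ := hD m hm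
  refine ⟨fun n => ψ (σ n), f, hψ.comp hσ, ?_⟩
  intro R φ x hφ
  have hc₀pos : 0 < c₀ := one_half_pos.trans_le hc₀.1
  -- (A) dilation by `c₀⁻¹`: exact covariance and transport of the uniformizing data
  have hA : Tendsto (fun n => bondDomainCrossingProb R (c₀ / 2 ^ (m (σ n)))) atTop
      (𝓝 (f (crossRatio x))) := by
    have hd := Summit.CriticalPhenomena.CardyFormulaZ2.Theorems.DyadicLattice.differentiableOn_mul_left
      ((c₀⁻¹ : ℝ) : ℂ) (closure R.carrier)
    have hi := Summit.CriticalPhenomena.CardyFormulaZ2.Theorems.DyadicLattice.injOn_mul_left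
      (c := ((c₀⁻¹ : ℝ) : ℂ)) (Complex.ofReal_ne_zero.2 (inv_pos.2 hc₀pos).ne')
      (closure R.carrier)
    have hlim := hconv _ _ x (hφ.imageUnivalent hd hi)
    refine hlim.congr fun n => ?_
    have e : (1 : ℝ) / 2 ^ (m (σ n)) = c₀⁻¹ * (c₀ / 2 ^ (m (σ n))) := by
      field_simp
    rw [e]
    exact Summit.CriticalPhenomena.CardyFormulaZ2.Theorems.DyadicLattice.bondDomainCrossingProb_dilate'
      R (inv_pos.2 hc₀pos) _
  -- (B) scale continuity: the meshes `c (σ n) / 2^(m (σ n))` and `c₀ / 2^(m (σ n))` are comparable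
  have hB : Tendsto (fun n => bondDomainCrossingProb R (c (σ n) * (1 / 2 ^ (m (σ n)))) -
      bondDomainCrossingProb R (c₀ * (1 / 2 ^ (m (σ n))))) atTop (𝓝 0) :=
    SubseqCIOfDyadic.tendsto_sub_of_scaleContinuity R (c := fun n => c (σ n))
      (e := fun n => (1 : ℝ) / 2 ^ (m (σ n))) hc₀pos
      (fun n => one_half_pos.trans_le (hc (σ n)).1) (hcc.comp hσ.tendsto_atTop)
      (fun n => by positivity) (SubseqCIOfDyadic.tendsto_one_div_two_pow (hm.comp hσ))
  -- (C) add
  have hC := hB.add hA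
  rw [zero_add] at hC
  refine hC.congr fun n => ?_
  show _ = bondDomainCrossingProb R (u (ψ (σ n)))
  rw [hu' (σ n), mul_one_div, mul_one_div, sub_add_cancel]

end Summit.CriticalPhenomena.CardyFormulaZ2.Cruxes.DyadicLatticeBetaLaw.Stubs

end
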